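import Literature.NumberTheory.EllipticCurves.RealLatticePeriodProofs
import Mathlib.Analysis.Calculus.FDeriv.Prod
import Mathlib.Analysis.Calculus.FDeriv.Mul
import Mathlib.Analysis.Calculus.Deriv.Comp
import Mathlib.LinearAlgebra.Matrix.Determinant.Basic
import Mathlib.LinearAlgebra.Matrix.ToLin
import Mathlib.Topology.Algebra.Module.Determinant
import HarnessLib

/-!
# The Jacobian of `(s, t) ↦ (re ℘(a s − i c t), im ℘(a s − i c t))`

Helper file for the support item `EllipticAreaIdentity` of route `MultivaluedCoV`
(`Summits/KontsevichZagierPeriods/KontsevichZagierPeriods/Theses/MultivaluedCoV.lean`).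

For a lattice `Λ` (Mathlib `PeriodPair` `L`), real functions `a, c` differentiable at `s, t` with
derivatives `a', c'`, and `ζ(s,t) = a(s) − i c(t) ∉ Λ`, the planar map
`Φ₀(s,t) = (re ℘(ζ(s,t)), im ℘(ζ(s,t)))` is differentiable with derivative
`E ∘ (℘'(ζ) · Z)`, where `Z(h₀,h₁) = a'h₀ − i c'h₁` and `E(w) = (re w, im w)` (chain rule;
`PeriodPair.hasDerivAt_weierstrassP`), and
`det Φ₀' = −a'c' · |℘'(ζ)|²` (`det_jacobian`): a holomorphic map scales areas by `|℘'|²`, and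
`(s,t) ↦ (a s, −c t)` by `|a'c'|`. With `a' = −1/√f(s)`, `c' = 1/√(−f(t))` and
`|℘'|² = |4℘³ − g₂℘ − g₃|` (`PeriodPair.derivWeierstrassP_sq`) this is the Jacobian identity
`|det Φ'| = |P(Φ)|/√(−f(s)f(t))` of crux `EllipticAreaCoV` (translation invariance of `dx/y`,
Silverman AEC III.5), in the pointwise form the change-of-variables move consumes
(`jacobian_identity`).

## References
* J. H. Silverman, *The Arithmetic of Elliptic Curves*, 2nd ed., III.5, VI.3.
* D. F. Lawden, *Elliptic Functions and Applications*, Springer 1989, §6.11.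
-/

noncomputable section

open scoped ComplexConjugate Topology PeriodPair
open Complex Set Filter ContinuousLinearMap

namespace Summit.KontsevichZagierPeriods.MultivaluedCoV.EllipticArea

variable {L : PeriodPair}

/-! ### The linear algebra: `E ∘ (m · Z)` and its determinant -/

/-- The derivative of `(h₀, h₁) ↦ a(h₀) − i c(h₁)` at a point where `a' , c'` are the
derivatives: `Z(h) = a'h₀ − i c'h₁`, as a real-linear map `ℝ² → ℂ`. (Written as a term; no
definition is introduced.) -/
theorem zetaDeriv_apply (a' c' : ℝ) (v : Fin 2 → ℝ) :
    (ofRealCLM.comp (a' • proj 0) - I • ofRealCLM.comp (c' • proj 1) :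
      (Fin 2 → ℝ) →L[ℝ] ℂ) v = (a' * v 0 : ℝ) - I * (c' * v 1 : ℝ) := by
  simp [smul_eq_mul]

/-- **The Jacobian determinant**: for `m ∈ ℂ` and reals `a', c'`, the real-linear map
`h ↦ (re, im)(m · (a'h₀ − i c'h₁))` of `ℝ²` has determinant `−a'c'|m|²`. -/
theorem det_jacobian (m : ℂ) (a' c' : ℝ) :
    ((ContinuousLinearMap.pi ![reCLM, imCLM] : ℂ →L[ℝ] (Fin 2 → ℝ)).comp
        (m • (ofRealCLM.comp (a' • proj 0) - I • ofRealCLM.comp (c' • proj 1) :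
          (Fin 2 → ℝ) →L[ℝ] ℂ))).det = -(a' * c') * Complex.normSq m := by
  rw [ContinuousLinearMap.det, ← LinearMap.det_toMatrix', Matrix.det_fin_two]
  simp only [LinearMap.toMatrix'_apply, ContinuousLinearMap.coe_coe,
    ContinuousLinearMap.comp_apply, smul_apply, zetaDeriv_apply,
    ContinuousLinearMap.pi_apply]
  simp [Complex.normSq_apply]
  ring

/-! ### The chain rule -/

/-- Derivative of `z ↦ a(z₀) − i c(z₁) : ℝ² → ℂ`. -/
theorem hasFDerivAt_zeta {a c : ℝ → ℝ} {a' c' : ℝ} {z : Fin 2 → ℝ}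
    (ha : HasDerivAt a a' (z 0)) (hc : HasDerivAt c c' (z 1)) :
    HasFDerivAt (fun z : Fin 2 → ℝ => ((a (z 0) : ℝ) : ℂ) - I * ((c (z 1) : ℝ) : ℂ))
      (ofRealCLM.comp (a' • proj 0) - I • ofRealCLM.comp (c' • proj 1)) z := by
  have h0 := HasDerivAt.comp_hasFDerivAt (h₂ := a) z ha (hasFDerivAt_apply (𝕜 := ℝ) 0 z)
  have h1 := HasDerivAt.comp_hasFDerivAt (h₂ := c) z hc (hasFDerivAt_apply (𝕜 := ℝ) 1 z)
  have h0' := ofRealCLM.hasFDerivAt.comp z h0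
  have h1' := ofRealCLM.hasFDerivAt.comp z h1
  exact h0'.sub (h1'.const_mul I)

/-- **Chain rule**: derivative of `Φ₀(z) = (re ℘(ζ z), im ℘(ζ z))`, `ζ z = a(z₀) − i c(z₁) ∉ Λ`. -/
theorem hasFDerivAt_phi {a c : ℝ → ℝ} {a' c' : ℝ} {z : Fin 2 → ℝ}
    (ha : HasDerivAt a a' (z 0)) (hc : HasDerivAt c c' (z 1))
    (hΛ : ((a (z 0) : ℝ) : ℂ) - I * ((c (z 1) : ℝ) : ℂ) ∉ L.lattice) :
    HasFDerivAt (fun z : Fin 2 → ℝ =>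
        (ContinuousLinearMap.pi ![reCLM, imCLM] : ℂ →L[ℝ] (Fin 2 → ℝ))
          (℘[L] (((a (z 0) : ℝ) : ℂ) - I * ((c (z 1) : ℝ) : ℂ))))
      ((ContinuousLinearMap.pi ![reCLM, imCLM] : ℂ →L[ℝ] (Fin 2 → ℝ)).comp
        (℘'[L] (((a (z 0) : ℝ) : ℂ) - I * ((c (z 1) : ℝ) : ℂ)) •
          (ofRealCLM.comp (a' • proj 0) - I • ofRealCLM.comp (c' • proj 1)))) z := by
  have hζ := hasFDerivAt_zeta ha hc
  have hP := HasDerivAt.comp_hasFDerivAt (h₂ := ℘[L]) z (PeriodPair.hasDerivAt_weierstrassP hΛ) hζ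
  have hE := (ContinuousLinearMap.pi ![reCLM, imCLM] : ℂ →L[ℝ] (Fin 2 → ℝ)).hasFDerivAt.comp z hP
  exact hE

/-! ### The Jacobian identity in the form consumed by the change-of-variables move -/

/-- `|℘'(w)|² = ‖4℘(w)³ − g₂℘(w) − g₃‖` off the lattice (`℘'² = 4℘³ − g₂℘ − g₃`). -/
theorem normSq_derivWeierstrassP {w : ℂ} (hw : w ∉ L.lattice) :
    Complex.normSq (℘'[L] w) = ‖4 * ℘[L] w ^ 3 - L.g₂ * ℘[L] w - L.g₃‖ := by
  rw [← L.derivWeierstrassP_sq w hw, norm_pow, Complex.normSq_eq_norm_sq]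

/-- **The Jacobian identity.** With `a' = −1/√f(s)`, `c' = 1/√(−f(t))` (`f(s) > 0 > f(t)`,
`f = 4x³ − g₂x − g₃` with the real invariants of `Λ`), `w = ℘(ζ)` for `ζ = a s − i c t ∉ Λ` with
`℘'(ζ) ≠ 0`, and `D` the derivative of `Φ₀` there:
`1/√(−f(s)f(t)) = (1/‖4w³ − g₂w − g₃‖) · |det D|` — i.e. `|det Φ'| = |P(Φ)|/√(−f(s)f(t))`. -/
theorem jacobian_identity {ζ : ℂ} (hζ : ζ ∉ L.lattice) (hζ' : ℘'[L] ζ ≠ 0)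
    {s t : ℝ} (hfs : 0 < 4 * s ^ 3 - L.g₂.re * s - L.g₃.re)
    (hft : 4 * t ^ 3 - L.g₂.re * t - L.g₃.re < 0) :
    1 / Real.sqrt (-((4 * s ^ 3 - L.g₂.re * s - L.g₃.re) * (4 * t ^ 3 - L.g₂.re * t - L.g₃.re))) =
      1 / ‖4 * ℘[L] ζ ^ 3 - L.g₂ * ℘[L] ζ - L.g₃‖ *
        |((ContinuousLinearMap.pi ![reCLM, imCLM] : ℂ →L[ℝ] (Fin 2 → ℝ)).comp
          (℘'[L] ζ • (ofRealCLM.comp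
            ((-(Real.sqrt (4 * s ^ 3 - L.g₂.re * s - L.g₃.re))⁻¹) • proj 0) -
            I • ofRealCLM.comp
              ((Real.sqrt (-(4 * t ^ 3 - L.g₂.re * t - L.g₃.re)))⁻¹ • proj 1) :
            (Fin 2 → ℝ) →L[ℝ] ℂ))).det| := by
  set fs := 4 * s ^ 3 - L.g₂.re * s - L.g₃.re with hfs_def
  set ft := 4 * t ^ 3 - L.g₂.re * t - L.g₃.re with hft_def
  set N := ‖4 * ℘[L] ζ ^ 3 - L.g₂ * ℘[L] ζ - L.g₃‖ with hN
  have hNsq : Complex.normSq (℘'[L] ζ) = N := normSq_derivWeierstrassP hζ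
  have hN0 : 0 < N := by
    rw [← hNsq]
    exact Complex.normSq_pos.mpr hζ'
  rw [det_jacobian, hNsq]
  have hP : 0 < Real.sqrt fs := Real.sqrt_pos.mpr hfs
  have hQ : 0 < Real.sqrt (-ft) := Real.sqrt_pos.mpr (by linarith)
  have hprod : Real.sqrt (-(fs * ft)) = Real.sqrt fs * Real.sqrt (-ft) := by
    rw [← Real.sqrt_mul hfs.le]; ring_nf
  rw [hprod, abs_mul, abs_of_pos hN0, abs_neg, abs_mul, abs_neg, abs_inv, abs_inv,
    abs_of_pos hP, abs_of_pos hQ]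
  field_simp

end Summit.KontsevichZagierPeriods.MultivaluedCoV.EllipticArea

end
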